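import Summits.RiemannHypothesis.RiemannHypothesis.Theses.ScrewPringsheim
import HarnessLib

/-!
# Route ScrewPringsheim (L30, X-15 «PRINGSHEIM BRIDGE») — `Assembly` (item stmt-RiemannHypothesis-22879)

`PringsheimBridge → RayFreeThinWall → Floor → RiemannHypothesis`: at the single step `h = 1`, the bridge turns the
one-sided lattice floor `Floor` = SEF(1) and the ray-free wall (`RayFreeThinWall.1`) into `LatticeCeiling 1`, and the
tree theorem `Splittings.ScrewLatticeThinWall.rh_of_latticeCeiling_of_thinWall` (lane (xii-n), X-10 of record) closes
with the thin wall (`RayFreeThinWall.2`). Two lines of logic = the planner's kernel-checked `assembly_holds`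
(rh-idea-1 g0, pub/ideators/rh-idea-1/pringsheim/Sketch4.lean sha16 09442582a4438e16; ref-2 g6 census #31 variant C
against the built route olean), written against the route decls. CONDITIONAL bookkeeping: `RayFreeThinWall` and
`Floor` stay OPEN (RH-implied); RH is not proved by this; nothing here bears on the truth of RH.
-/

-- D-0017: `Summit.RiemannHypothesis.RiemannHypothesis.…` duplicates the namespace BY DESIGN (single-problem summit).
set_option linter.dupNamespace false

namespace Summit.RiemannHypothesis.RiemannHypothesis.Theorems.ScrewPringsheim

/-- **`Assembly` (item stmt-RiemannHypothesis-22879) holds**: bridge at `h = 1` (floor + ray-free wall ⇒ ceiling),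
then `rh_of_latticeCeiling_of_thinWall one_pos` with the thin wall (planner rh-idea-1's `assembly_holds`, 09442582). -/
theorem assembly_proof :
    Summit.RiemannHypothesis.RiemannHypothesis.Theses.ScrewPringsheim.Assembly :=
  fun h₁ h₂ h₃ ↦
    Splittings.ScrewLatticeThinWall.rh_of_latticeCeiling_of_thinWall one_pos (h₁ 1 one_pos h₃ h₂.1) h₂.2

end Summit.RiemannHypothesis.RiemannHypothesis.Theorems.ScrewPringsheim
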